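/-
Copyright: b2b-lace packet (literature seat, gen 14).  [NoBLE17-I] §5.3.1–§5.3.2: the THREE- and FOUR-TAIL word
sums of the repulsive triangle / square extractions (5.41)/(5.42) are TRAIL REMAINDERS `Rem_{[m,n,k]}`,
`Rem_{[m,n,k,l]}` ([NoBLE17-I] (5.36)–(5.38)), and the open repulsive bubble / triangle / square bounds at ABSTRACT
remainder-kernel constants (the slots of `NbwRemainderFrame.IsRemKernelConst`), DISCHARGED over the tree's extraction
theorems.  Proofs only; no named fact; no numeral; no dimension.
-/
import Literature.Probability.FitznerVanDerHofstad2017.TrailRemWordSums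
import Literature.Probability.FitznerVanDerHofstad2017.RepulsivePolygonMultiplicities
import HarnessLib

/-!
# [NoBLE17] (5.40)–(5.42) at abstract remainder-kernel constants: compositions of length 3 and 4

CITATION HEADER (PLACEMENT v2). This module is part of a certified REPRODUCTION of:
R. Fitzner, R. van der Hofstad, *Generalized approach to the non-backtracking lace expansion*,
Probab. Theory Related Fields 169 (2017) 1041–1119 [NoBLE17], §5.3.1–§5.3.2, and
*Mean-field behavior for nearest-neighbor percolation in d > 10*, Electron. J. Probab. 22 (2017), no. 43 [FvdH17],
§4.2.  Origin: build `lace` (host summit CriticalPhenomena), literature seat.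

WHAT THIS FILE DOES.  `TrailRemWordSums` (carver/lean2, node N68c-BRIDGE) identified the ONE- and TWO-TAIL word sums
of the extraction bounds with the trail remainders `Rem_{[M]}(p;x)`, `Rem_{[M−m₂,m₂]}(p;x)` of `NbwRemainderFrame`
(`trailRem d p c x = ((a_{c₁} ⋆ ⋯ ⋆ a_{c_n}) ⋆ τ_p^{⋆n})(x)`, [NoBLE17] (5.36)–(5.38)) and wrote the repulsive BUBBLE
([NoBLE17] (5.40)) at abstract slot constants; its docstring ends "Compositions of length 3 and 4 (repulsive triangle
/ square) follow from the PEEL lemma in the same way once the extraction right-hand sides are fixed."  The extraction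
right-hand sides ARE fixed (literature seat gens 11–13: `RepulsiveTriangleExtraction.sum_sum_diagT_le_extraction`
= (5.41), `RepulsiveSquareExtraction.sum3_diagS_le_extraction` = (5.42), with closed-form multiplicities in
`RepulsivePolygonMultiplicities`), and this file does exactly that:

* (A) the one-step tail identity `τ_p^{⋆(n+1)}(z − a) = Σ_v τ_p(a,v) τ_p^{⋆n}(z − v)` and its finite-partial-sum
  inequality (`convPow_tau_succ_eq_tsum`, `sum_tau_mul_convPow_tau_le`), whence the THREE- and FOUR-fold shifted
  sums `Σ_{v,y} τ(a,v) τ(v+b,y) τ(y+c,x) ≤ τ_p^{⋆3}(x−c−b−a)`, `Σ_{v,y,w} … ≤ τ_p^{⋆4}(x−e−c−b−a)`;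
* (B) `Rem_{[m,n,k]}(p;x) = Σ_{u₁,u₂,u₃} τ_p^{⋆3}(x − u₁(m) − u₂(n) − u₃(k))` and the length-4 analogue (PEEL twice /
  three times: `trailRem_triple_eq`, `trailRem_quad_eq`);
* (C) THREE TAILS `Σ_{(u₁,u₂,u₃)} Σ_{v∈S₁} Σ_{y∈S₂} τ(u₁(m),v) τ(v+u₂(n),y) τ(y+u₃(k),x) ≤ Rem_{[m,n,k]}(p;x)` and FOUR
  TAILS (every finite `S_i`, `p < p_c`), and the SLOT forms `… ≤ Γ̄₂(p)³ R`, `… ≤ Γ̄₂(p)⁴ R` for valid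
  remainder-kernel constants `R` (`IsRemKernelConst d [m,n,k] X R`, `x ∈ X`) — [NoBLE17] §5.3.2 first display;
* (D) the open repulsive TRIANGLE and SQUARE at abstract slot constants, in `hE`-form (any `D` obeying the (5.41)- /
  (5.42)-shaped extraction inequality) AND DISCHARGED over the tree objects:
  `Σ_{v∈S₁}Σ_{y∈S₂} 𝓣_{m₁,m₂,m₃}(v,y,x) ≤ Σ_{L=m}^{M−1} C(L+2−m,2) a_L(x) p^L + C(M+1−m,2) p^M Γ̄₂ R₁ + (M−m) p^M Γ̄₂² R₂
  + p^M Γ̄₂³ R₃` (`m = m_{1,3}`; `R₁, R₂, R₃` valid for `[M]`, `[M−m₃, m₃]`, `[M−m₂−m₃, m₂, m₃]`), and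
  `Σ_{v,y,w} 𝓢_{m₁,…,m₄}(v,y,w,x) ≤ Σ_L C(L+3−m,3) a_L(x) p^L + C(M+2−m,3) p^M Γ̄₂ R₁ + C(M+1−m,2) p^M Γ̄₂² R₂
  + (M−m) p^M Γ̄₂³ R₃ + p^M Γ̄₂⁴ R₄` (`m = m_{1,4}`), plus the repulsive BUBBLE discharged (`sum_diagB_le_slots`, the
  `hE` of `TrailRemWordSums.sum_le_repBubble_slots` fed with `RepulsiveBubbleExtraction.sum_diagB_le_extraction`).
  These are the `Percolation.nb` cell-11 (`x = 0`, closed polygons) / cell-12 (`x ≠ 0`, open polygons) repulsive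
  bubble / triangle / square bounds with EVERY remainder read a slot (`RemRead.cl j` / `RemRead.op j`, j = 1, 2, 3 of
  `NobleImprovementInputsRem`), the multiplicities being the ones the extraction DERIVES (HOME D57 /
  `RepulsivePolygonMultiplicities`: triangle one-tail `C(M+1−m,2)`, square one-tail `C(M+2−m,3)`, two-tail
  `C(M+1−m,2)`; the printed `(5.42)` one-tail `C(M+3−m,3)` is a valid over-count: `sum3_diagS_le_slots_printedOneTail`).

Printed `R` ([NoBLE17] §5.3.2 first display): `R = (2d)^M K_{n,M}(x)` (kernel-valid: `NbwRemainderFramePrinted`);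
N53 `R = J_n` (`isRemKernelConst_nbwJ`).  Nothing here is a cited hypothesis; `hE` is discharged in this very file.

[cite: FitznerVanDerHofstad2016NoBLE, §5.3.1 (5.36)–(5.38) p. 1097; §5.3.2 first display (5.39) p. 1097, (5.40)–(5.42) p. 1098]
[cite: FitznerVanDerHofstad2017, §4.2 (4.18) and the display after it (arXiv:1506.07977v2 pp. 36–37 = EJP pp. 33–34); notebook Percolation.nb cells 11, 12]
-/

noncomputable section

namespace Literature.Probability.FitznerVanDerHofstad2017

open MeasureTheory Real Finset Filter
open scoped BigOperators
open Literature.Probability.LatticeModels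
open Literature.Probability.Percolation
open Literature.Barriers.CriticalPhenomena
open Literature.Barriers.CriticalPhenomena.SpreadOutIsing (delta0 latticeConv convPow latticeConv_comm
  latticeConv_delta0_left latticeConv_delta0 latticeConv_assoc_of_bdd abs_latticeConv_le_of_bdd abs_convPow_le
  delta0_nonneg)

variable {d : ℕ}

/-! ### A. One more two-point line: `τ_p^{⋆(n+1)}(z − a) = Σ_v τ_p(a, v) τ_p^{⋆n}(z − v)` -/

/-- `τ_p^{⋆(n+1)}(z − a) = Σ_v τ_p(a, v) τ_p^{⋆n}(z − v)` (translation invariance of `τ_p`). [folklore] -/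
theorem convPow_tau_succ_eq_tsum (p : unitInterval) (n : ℕ) (a z : Site d) :
    convPow (tau d p 0) (n + 1) (z - a) = ∑' v, tau d p a v * convPow (tau d p 0) n (z - v) := by
  show (∑' y, convPow (tau d p 0) n y * tau d p 0 (z - a - y)) = _
  rw [← (Equiv.subLeft z).tsum_eq (fun y => convPow (tau d p 0) n y * tau d p 0 (z - a - y))]
  refine tsum_congr fun v => ?_
  rw [Equiv.subLeft_apply, sub_sub_sub_cancel_left, ← tau_eq_tau_zero_sub p a v, mul_comm]

/-- `v ↦ τ_p(a, v) τ_p^{⋆n}(z − v)` is summable below `p_c` (`τ_p` summable, `τ_p^{⋆n}` bounded). [folklore] -/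
theorem summable_tau_mul_convPow_tau (hd : 2 ≤ d) (p : unitInterval) (hp : p < criticalProbI d) (n : ℕ)
    (a z : Site d) : Summable fun v => tau d p a v * convPow (tau d p 0) n (z - v) := by
  have hp' : (p : ℝ) < criticalProb (zdGraph d) (0 : Site d) := hp
  have hs : Summable fun v => tau d p 0 (v - a) :=
    (summable_tau_of_lt_criticalProb hd p hp').comp_injective (sub_left_injective (b := a))
  refine (hs.mul_right ((∑' w, |tau d p 0 w|) ^ n)).of_nonneg_of_le
    (fun v => mul_nonneg (tau_nonneg p _ _) (convPow_tau_nonneg p n _)) fun v => ?_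
  rw [← tau_eq_tau_zero_sub p a v]
  exact mul_le_mul_of_nonneg_left ((le_abs_self _).trans (abs_convPow_tau_le hd p hp n _)) (tau_nonneg p _ _)

/-- **One more line, finite partial sums**: `Σ_{v∈S} τ_p(a, v) τ_p^{⋆n}(z − v) ≤ τ_p^{⋆(n+1)}(z − a)` (`p < p_c`;
equality for `S = ℤ^d`). [folklore] -/
theorem sum_tau_mul_convPow_tau_le (hd : 2 ≤ d) (p : unitInterval) (hp : p < criticalProbI d) (n : ℕ)
    (a z : Site d) (S : Finset (Site d)) :
    ∑ v ∈ S, tau d p a v * convPow (tau d p 0) n (z - v) ≤ convPow (tau d p 0) (n + 1) (z - a) := by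
  rw [convPow_tau_succ_eq_tsum]
  exact Summable.sum_le_tsum S (fun v _ => mul_nonneg (tau_nonneg p _ _) (convPow_tau_nonneg p n _))
    (summable_tau_mul_convPow_tau hd p hp n a z)

/-- **Three lines**: `Σ_{v∈S₁} Σ_{y∈S₂} τ_p(a, v) τ_p(v + b, y) τ_p(y + c, x) ≤ τ_p^{⋆3}(x − c − b − a)` (`p < p_c`,
finite `S₁, S₂`). [folklore] -/
theorem sum_sum_tau_mul_tau_mul_tau_shift_le (hd : 2 ≤ d) (p : unitInterval) (hp : p < criticalProbI d)
    (a b c x : Site d) (S₁ S₂ : Finset (Site d)) :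
    ∑ v ∈ S₁, ∑ y ∈ S₂, tau d p a v * tau d p (v + b) y * tau d p (y + c) x ≤
      convPow (tau d p 0) 3 (x - c - b - a) := by
  have h1 : ∀ v ∈ S₁, ∑ y ∈ S₂, tau d p a v * tau d p (v + b) y * tau d p (y + c) x ≤
      tau d p a v * convPow (tau d p 0) 2 (x - c - b - v) := fun v _ => by
    have h := sum_tau_mul_tau_shift_le hd p hp (v + b) c x S₂
    rw [show x - c - (v + b) = x - c - b - v by abel] at h
    calc ∑ y ∈ S₂, tau d p a v * tau d p (v + b) y * tau d p (y + c) x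
        = tau d p a v * ∑ y ∈ S₂, tau d p (v + b) y * tau d p (y + c) x := by
          rw [Finset.mul_sum]
          exact Finset.sum_congr rfl fun y _ => mul_assoc _ _ _
      _ ≤ tau d p a v * convPow (tau d p 0) 2 (x - c - b - v) := mul_le_mul_of_nonneg_left h (tau_nonneg p _ _)
  exact (Finset.sum_le_sum h1).trans (sum_tau_mul_convPow_tau_le hd p hp 2 a (x - c - b) S₁)

/-- **Four lines**: `Σ_{v,y,w} τ_p(a, v) τ_p(v + b, y) τ_p(y + c, w) τ_p(w + e, x) ≤ τ_p^{⋆4}(x − e − c − b − a)`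
(`p < p_c`, finite `S₁, S₂, S₃`). [folklore] -/
theorem sum3_tau_mul4_shift_le (hd : 2 ≤ d) (p : unitInterval) (hp : p < criticalProbI d)
    (a b c e x : Site d) (S₁ S₂ S₃ : Finset (Site d)) :
    ∑ v ∈ S₁, ∑ y ∈ S₂, ∑ w ∈ S₃, tau d p a v * tau d p (v + b) y * tau d p (y + c) w * tau d p (w + e) x ≤
      convPow (tau d p 0) 4 (x - e - c - b - a) := by
  have h1 : ∀ v ∈ S₁,
      ∑ y ∈ S₂, ∑ w ∈ S₃, tau d p a v * tau d p (v + b) y * tau d p (y + c) w * tau d p (w + e) x ≤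
        tau d p a v * convPow (tau d p 0) 3 (x - e - c - b - v) := fun v _ => by
    have h := sum_sum_tau_mul_tau_mul_tau_shift_le hd p hp (v + b) c e x S₂ S₃
    rw [show x - e - c - (v + b) = x - e - c - b - v by abel] at h
    calc ∑ y ∈ S₂, ∑ w ∈ S₃, tau d p a v * tau d p (v + b) y * tau d p (y + c) w * tau d p (w + e) x
        = tau d p a v * ∑ y ∈ S₂, ∑ w ∈ S₃, tau d p (v + b) y * tau d p (y + c) w * tau d p (w + e) x := by
          rw [Finset.mul_sum]
          refine Finset.sum_congr rfl fun y _ => ?_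
          rw [Finset.mul_sum]
          exact Finset.sum_congr rfl fun w _ => by ring
      _ ≤ tau d p a v * convPow (tau d p 0) 3 (x - e - c - b - v) := mul_le_mul_of_nonneg_left h (tau_nonneg p _ _)
  exact (Finset.sum_le_sum h1).trans (sum_tau_mul_convPow_tau_le hd p hp 3 a (x - e - c - b) S₁)

/-! ### B. Compositions of length 3 and 4, peeled -/

/-- **`Rem_{[m,n,k]}` peeled**: `Rem_{[m,n,k]}(p;x) = Σ_{u₁ ∈ m-trails} Σ_{u₂ ∈ n-trails} Σ_{u₃ ∈ k-trails}
τ_p^{⋆3}(x − u₁(m) − u₂(n) − u₃(k))` (`p < p_c`). [cite: FitznerVanDerHofstad2016NoBLE, §5.3.1 (5.36)–(5.38) p. 1097] -/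
theorem trailRem_triple_eq (hd : 2 ≤ d) (p : unitInterval) (hp : p < criticalProbI d) (m n k : ℕ)
    (x : Site d) :
    trailRem d p [m, n, k] x = ∑ u₁ ∈ trailWords d m, ∑ u₂ ∈ trailWords d n, ∑ u₃ ∈ trailWords d k,
      convPow (tau d p 0) 3 (x - wordPos u₁ m - wordPos u₂ n - wordPos u₃ k) := by
  rw [trailRem_cons hd p hp m [n, k] x]
  refine Finset.sum_congr rfl fun u₁ _ => ?_
  rw [show [n, k].length + 1 = 3 from rfl, latticeConv_pieces_cons (abs_convPow_tau_le hd p hp 3) n [k]]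
  refine Finset.sum_congr rfl fun u₂ _ => ?_
  rw [pieces_singleton, ← sum_trailWords_eq_latticeConv]

/-- **`Rem_{[m,n,k,l]}` peeled**: `Rem_{[m,n,k,l]}(p;x) = Σ_{u₁,u₂,u₃,u₄} τ_p^{⋆4}(x − u₁(m) − u₂(n) − u₃(k) − u₄(l))`
(`p < p_c`). [cite: FitznerVanDerHofstad2016NoBLE, §5.3.1 (5.36)–(5.38) p. 1097] -/
theorem trailRem_quad_eq (hd : 2 ≤ d) (p : unitInterval) (hp : p < criticalProbI d) (m n k l : ℕ)
    (x : Site d) :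
    trailRem d p [m, n, k, l] x =
      ∑ u₁ ∈ trailWords d m, ∑ u₂ ∈ trailWords d n, ∑ u₃ ∈ trailWords d k, ∑ u₄ ∈ trailWords d l,
        convPow (tau d p 0) 4 (x - wordPos u₁ m - wordPos u₂ n - wordPos u₃ k - wordPos u₄ l) := by
  rw [trailRem_cons hd p hp m [n, k, l] x]
  refine Finset.sum_congr rfl fun u₁ _ => ?_
  rw [show [n, k, l].length + 1 = 4 from rfl, latticeConv_pieces_cons (abs_convPow_tau_le hd p hp 4) n [k, l]]
  refine Finset.sum_congr rfl fun u₂ _ => ?_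
  rw [latticeConv_pieces_cons (abs_convPow_tau_le hd p hp 4) k [l]]
  refine Finset.sum_congr rfl fun u₃ _ => ?_
  rw [pieces_singleton, ← sum_trailWords_eq_latticeConv]

/-! ### C. Three tails and four tails; slot forms -/

/-- **THREE TAILS**: `Σ_{(u₁,u₂,u₃) ∈ m-trails × n-trails × k-trails} Σ_{v∈S₁} Σ_{y∈S₂} τ_p(u₁(m), v) τ_p(v + u₂(n), y)
τ_p(y + u₃(k), x) ≤ Rem_{[m,n,k]}(p;x)` for every finite `S₁, S₂` (`p < p_c`) — the three-tail family of the
repulsive-triangle extraction (5.41) and the three-tail family of the square (5.42).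
[cite: FitznerVanDerHofstad2016NoBLE, §5.3.1 (5.36)–(5.38) p. 1097, §5.3.2 (5.41)–(5.42) p. 1098] -/
theorem sum_prod3_trailWords_le_trailRem (hd : 2 ≤ d) (p : unitInterval) (hp : p < criticalProbI d)
    (m n k : ℕ) (x : Site d) (S₁ S₂ : Finset (Site d)) :
    ∑ t ∈ (trailWords d m) ×ˢ ((trailWords d n) ×ˢ (trailWords d k)), ∑ v ∈ S₁, ∑ y ∈ S₂,
        tau d p (wordPos t.1 m) v * tau d p (v + wordPos t.2.1 n) y * tau d p (y + wordPos t.2.2 k) x ≤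
      trailRem d p [m, n, k] x := by
  rw [trailRem_triple_eq hd p hp, Finset.sum_product]
  refine Finset.sum_le_sum fun u₁ _ => ?_
  rw [Finset.sum_product]
  refine Finset.sum_le_sum fun u₂ _ => Finset.sum_le_sum fun u₃ _ => ?_
  refine (sum_sum_tau_mul_tau_mul_tau_shift_le hd p hp _ _ _ x S₁ S₂).trans (le_of_eq ?_)
  dsimp only
  congr 1
  abel

/-- **FOUR TAILS**: `Σ_{(u₁,…,u₄)} Σ_{v∈S₁} Σ_{y∈S₂} Σ_{w∈S₃} τ_p(u₁(m), v) τ_p(v + u₂(n), y) τ_p(y + u₃(k), w)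
τ_p(w + u₄(l), x) ≤ Rem_{[m,n,k,l]}(p;x)` for every finite `S₁, S₂, S₃` (`p < p_c`) — the four-tail family of (5.42).
[cite: FitznerVanDerHofstad2016NoBLE, §5.3.1 (5.36)–(5.38) p. 1097, §5.3.2 (5.42) p. 1098] -/
theorem sum_prod4_trailWords_le_trailRem (hd : 2 ≤ d) (p : unitInterval) (hp : p < criticalProbI d)
    (m n k l : ℕ) (x : Site d) (S₁ S₂ S₃ : Finset (Site d)) :
    ∑ t ∈ (trailWords d m) ×ˢ ((trailWords d n) ×ˢ ((trailWords d k) ×ˢ (trailWords d l))),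
        ∑ v ∈ S₁, ∑ y ∈ S₂, ∑ w ∈ S₃,
          tau d p (wordPos t.1 m) v * tau d p (v + wordPos t.2.1 n) y * tau d p (y + wordPos t.2.2.1 k) w *
            tau d p (w + wordPos t.2.2.2 l) x ≤
      trailRem d p [m, n, k, l] x := by
  rw [trailRem_quad_eq hd p hp, Finset.sum_product]
  refine Finset.sum_le_sum fun u₁ _ => ?_
  rw [Finset.sum_product]
  refine Finset.sum_le_sum fun u₂ _ => ?_
  rw [Finset.sum_product]
  refine Finset.sum_le_sum fun u₃ _ => Finset.sum_le_sum fun u₄ _ => ?_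
  refine (sum3_tau_mul4_shift_le hd p hp _ _ _ _ x S₁ S₂ S₃).trans (le_of_eq ?_)
  dsimp only
  congr 1
  abel

/-- THREE TAILS against a valid remainder-kernel constant: `… ≤ Γ̄₂(p)³ R` for `x ∈ X`,
`IsRemKernelConst d [m,n,k] X R`. [cite: FitznerVanDerHofstad2016NoBLE, §5.3.2 first display p. 1097] -/
theorem sum_prod3_trailWords_le_slot (hd : 2 ≤ d) {m n k : ℕ} {X : Set (Site d)} {R : ℝ}
    (hR : IsRemKernelConst d [m, n, k] X R) (p : unitInterval) (hp : p < criticalProbI d) {x : Site d}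
    (hx : x ∈ X) (S₁ S₂ : Finset (Site d)) :
    ∑ t ∈ (trailWords d m) ×ˢ ((trailWords d n) ×ˢ (trailWords d k)), ∑ v ∈ S₁, ∑ y ∈ S₂,
        tau d p (wordPos t.1 m) v * tau d p (v + wordPos t.2.1 n) y * tau d p (y + wordPos t.2.2 k) x ≤
      nobleSup2 d p ^ 3 * R :=
  (sum_prod3_trailWords_le_trailRem hd p hp m n k x S₁ S₂).trans (by simpa using hR p hp x hx)

/-- FOUR TAILS against a valid remainder-kernel constant: `… ≤ Γ̄₂(p)⁴ R` for `x ∈ X`,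
`IsRemKernelConst d [m,n,k,l] X R`. [cite: FitznerVanDerHofstad2016NoBLE, §5.3.2 first display p. 1097] -/
theorem sum_prod4_trailWords_le_slot (hd : 2 ≤ d) {m n k l : ℕ} {X : Set (Site d)} {R : ℝ}
    (hR : IsRemKernelConst d [m, n, k, l] X R) (p : unitInterval) (hp : p < criticalProbI d) {x : Site d}
    (hx : x ∈ X) (S₁ S₂ S₃ : Finset (Site d)) :
    ∑ t ∈ (trailWords d m) ×ˢ ((trailWords d n) ×ˢ ((trailWords d k) ×ˢ (trailWords d l))),
        ∑ v ∈ S₁, ∑ y ∈ S₂, ∑ w ∈ S₃,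
          tau d p (wordPos t.1 m) v * tau d p (v + wordPos t.2.1 n) y * tau d p (y + wordPos t.2.2.1 k) w *
            tau d p (w + wordPos t.2.2.2 l) x ≤
      nobleSup2 d p ^ 4 * R :=
  (sum_prod4_trailWords_le_trailRem hd p hp m n k l x S₁ S₂ S₃).trans (by simpa using hR p hp x hx)

/-! ### D. The repulsive bubble at abstract slots — DISCHARGED over `RepulsiveBubbleExtraction` -/

/-- **The open repulsive bubble at abstract remainder-kernel constants, discharged** (`d ≥ 2`, `p < p_c`, `m₂ ≤ M`,
`x ∈ X`; `R₁` valid for `[M]`, `R₂` valid for `[M−m₂, m₂]` on `X`; every finite `S`):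
`Σ_{y∈S} 𝓑_{m₁,m₂}(y,x) ≤ Σ_{L=m₁+m₂}^{M−1} (L+1−m₁−m₂) a_L(x) p^L + (M−m₁−m₂) p^M Γ̄₂ R₁ + p^M Γ̄₂² R₂` — the `hE`
of `TrailRemWordSums.sum_le_repBubble_slots` fed with the kernel theorem `sum_diagB_le_extraction` ([NoBLE17] (5.40)).
Cell 11 (`x = 0`, closed repulsive bubble) and cell 12 (`x ≠ 0`) of `Percolation.nb` at slots `RemRead.cl 1`/`op 1`.
[cite: FitznerVanDerHofstad2016NoBLE, §5.3.2 (5.40) p. 1098, first display p. 1097]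
[cite: FitznerVanDerHofstad2017, notebook Percolation.nb cells 11, 12] -/
theorem sum_diagB_le_slots (hd : 2 ≤ d) (p : unitInterval) (hp : p < criticalProbI d) {m₁ m₂ M : ℕ}
    (hm : m₂ ≤ M) {x : Site d} {X : Set (Site d)} (hx : x ∈ X) {R₁ R₂ : ℝ} (hR₁ : IsRemKernelConst d [M] X R₁)
    (hR₂ : IsRemKernelConst d [M - m₂, m₂] X R₂) (S : Finset (Site d)) :
    ∑ y ∈ S, diagB d p m₁ m₂ y x ≤
      (∑ L ∈ Finset.Ico (m₁ + m₂) M,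
          ((L + 1 - m₁ - m₂ : ℕ) : ℝ) * ((trailWordsTo d L x).card : ℝ) * (p : ℝ) ^ L) +
        ((M - m₁ - m₂ : ℕ) : ℝ) * ((p : ℝ) ^ M * (nobleSup2 d p * R₁)) +
          (p : ℝ) ^ M * (nobleSup2 d p ^ 2 * R₂) :=
  sum_le_repBubble_slots (D := fun y => diagB d p m₁ m₂ y x) (sum_diagB_le_extraction p m₁ m₂ M x)
    hd hp hm hx hR₁ hR₂ S

/-- The same, summed over `ℤ^d` (`SumLE`). [cite: FitznerVanDerHofstad2016NoBLE, §5.3.2 (5.40) p. 1098] -/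
theorem sumLE_diagB_slots (hd : 2 ≤ d) (p : unitInterval) (hp : p < criticalProbI d) {m₁ m₂ M : ℕ}
    (hm : m₂ ≤ M) {x : Site d} {X : Set (Site d)} (hx : x ∈ X) {R₁ R₂ : ℝ} (hR₁ : IsRemKernelConst d [M] X R₁)
    (hR₂ : IsRemKernelConst d [M - m₂, m₂] X R₂) :
    SumLE (fun y => diagB d p m₁ m₂ y x)
      ((∑ L ∈ Finset.Ico (m₁ + m₂) M,
          ((L + 1 - m₁ - m₂ : ℕ) : ℝ) * ((trailWordsTo d L x).card : ℝ) * (p : ℝ) ^ L) +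
        ((M - m₁ - m₂ : ℕ) : ℝ) * ((p : ℝ) ^ M * (nobleSup2 d p * R₁)) +
          (p : ℝ) ^ M * (nobleSup2 d p ^ 2 * R₂)) :=
  sumLE_repBubble_slots (D := fun y => diagB d p m₁ m₂ y x) (sum_diagB_le_extraction p m₁ m₂ M x)
    (fun y => diagB_nonneg p m₁ m₂ y x) hd hp hm hx hR₁ hR₂

/-! ### E. The repulsive triangle at abstract slots (hE-form, then discharged) -/

section RepulsiveTriangleCell

variable {p : unitInterval} {m₁ m₂ m₃ M : ℕ} {x : Site d} {D : Site d → Site d → ℝ}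
  (hE : ∀ S₁ S₂ : Finset (Site d), ∑ v ∈ S₁, ∑ y ∈ S₂, D v y ≤
    (∑ L ∈ Finset.Ico (m₁ + m₂ + m₃) M,
        (((L + 2 - (m₁ + m₂ + m₃)).choose 2 : ℕ) : ℝ) * ((trailWordsTo d L x).card : ℝ) * (p : ℝ) ^ L) +
      (((M + 1 - (m₁ + m₂ + m₃)).choose 2 : ℕ) : ℝ) *
          ((p : ℝ) ^ M * ∑ u ∈ trailWords d M, tau d p 0 (x - wordPos u M)) +
        ((M - (m₁ + m₂ + m₃) : ℕ) : ℝ) * ((p : ℝ) ^ (M - m₃) * (p : ℝ) ^ m₃ *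
          ∑ uu ∈ idxTwoTail (d := d) m₃ M,
            ∑ y ∈ S₂, tau d p (wordPos uu.1 (M - m₃)) y * tau d p (y + wordPos uu.2 m₃) x) +
          (p : ℝ) ^ (M - (m₂ + m₃)) * (p : ℝ) ^ m₂ * (p : ℝ) ^ m₃ *
            ∑ t ∈ idxThreeTailT (d := d) m₂ m₃ M, ∑ v ∈ S₁, ∑ y ∈ S₂,
              tau d p (wordPos t.1 (M - (m₂ + m₃))) v * tau d p (v + wordPos t.2.1 m₂) y *
                tau d p (y + wordPos t.2.2 m₃) x)

include hE

/-- **The repulsive triangle at abstract remainder-kernel constants, all finite `S₁, S₂`** (`d ≥ 2`, `p < p_c`,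
`m₂ + m₃ ≤ M`, `x ∈ X`; `R₁` valid for `[M]`, `R₂` for `[M−m₃, m₃]`, `R₃` for `[M−m₂−m₃, m₂, m₃]` on `X`; `hE` =
the (5.41)-shaped extraction inequality with binomial multiplicities, e.g. `sum_sum_diagT_le_extraction_choose`):
`Σ_{v∈S₁} Σ_{y∈S₂} D(v,y) ≤ Σ_{L=m_{1,3}}^{M−1} C(L+2−m_{1,3},2) a_L(x) p^L + C(M+1−m_{1,3},2) p^M Γ̄₂ R₁`
` + (M−m_{1,3}) p^M Γ̄₂² R₂ + p^M Γ̄₂³ R₃` — (5.41) with each tail `(2dμ̄)^M (D^{⋆M} ⋆ G^{⋆n})(x)` a slot `p^M Γ̄₂ⁿ Rₙ`.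
[cite: FitznerVanDerHofstad2016NoBLE, §5.3.2 (5.41) p. 1098; first display p. 1097]
[cite: FitznerVanDerHofstad2017, notebook Percolation.nb cells 11, 12 (Bound[OpenTriangle,m,s], second Min-argument)] -/
theorem sum_sum_le_repTriangle_slots (hd : 2 ≤ d) (hp : p < criticalProbI d) (hm : m₂ + m₃ ≤ M)
    {X : Set (Site d)} (hx : x ∈ X) {R₁ R₂ R₃ : ℝ} (hR₁ : IsRemKernelConst d [M] X R₁)
    (hR₂ : IsRemKernelConst d [M - m₃, m₃] X R₂) (hR₃ : IsRemKernelConst d [M - (m₂ + m₃), m₂, m₃] X R₃)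
    (S₁ S₂ : Finset (Site d)) :
    ∑ v ∈ S₁, ∑ y ∈ S₂, D v y ≤
      (∑ L ∈ Finset.Ico (m₁ + m₂ + m₃) M,
          (((L + 2 - (m₁ + m₂ + m₃)).choose 2 : ℕ) : ℝ) * ((trailWordsTo d L x).card : ℝ) * (p : ℝ) ^ L) +
        (((M + 1 - (m₁ + m₂ + m₃)).choose 2 : ℕ) : ℝ) * ((p : ℝ) ^ M * (nobleSup2 d p * R₁)) +
          ((M - (m₁ + m₂ + m₃) : ℕ) : ℝ) * ((p : ℝ) ^ M * (nobleSup2 d p ^ 2 * R₂)) +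
            (p : ℝ) ^ M * (nobleSup2 d p ^ 3 * R₃) := by
  have hp0 : 0 ≤ (p : ℝ) := p.2.1
  have h3 : m₃ ≤ M := (Nat.le_add_left m₃ m₂).trans hm
  refine (hE S₁ S₂).trans (add_le_add (add_le_add (add_le_add le_rfl ?_) ?_) ?_)
  · exact mul_le_mul_of_nonneg_left
      (mul_le_mul_of_nonneg_left (sum_trailWords_tau_le_slot hR₁ p hp hx) (pow_nonneg hp0 M)) (Nat.cast_nonneg _)
  · rw [← pow_add, Nat.sub_add_cancel h3]
    exact mul_le_mul_of_nonneg_left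
      (mul_le_mul_of_nonneg_left (sum_prod_trailWords_le_slot hd hR₂ p hp hx S₂) (pow_nonneg hp0 M))
      (Nat.cast_nonneg _)
  · rw [← pow_add, ← pow_add, show M - (m₂ + m₃) + m₂ + m₃ = M by omega]
    exact mul_le_mul_of_nonneg_left (sum_prod3_trailWords_le_slot hd hR₃ p hp hx S₁ S₂) (pow_nonneg hp0 M)

end RepulsiveTriangleCell

/-- **The open repulsive triangle `𝓣_{m₁,m₂,m₃}` at abstract remainder-kernel constants, DISCHARGED** over
`sum_sum_diagT_le_extraction` ([NoBLE17] (5.41), literature seat gen 11) with the closed-form multiplicities of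
`RepulsivePolygonMultiplicities` (one-tail `C(M+1−m_{1,3},2)`, the first printed form; HOME D57):
`Σ_{v∈S₁} Σ_{y∈S₂} 𝓣(v,y,x) ≤ Σ_L C(L+2−m,2) a_L(x) p^L + C(M+1−m,2) p^M Γ̄₂ R₁ + (M−m) p^M Γ̄₂² R₂ + p^M Γ̄₂³ R₃`.
Cells 11/12 of `Percolation.nb` (closed triangle at `x = 0` / open triangle at `x ≠ 0`), slots `RemRead.cl 2` / `op 2`.
[cite: FitznerVanDerHofstad2016NoBLE, §5.3.2 (5.41) p. 1098; first display p. 1097]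
[cite: FitznerVanDerHofstad2017, notebook Percolation.nb cells 11, 12] -/
theorem sum_sum_diagT_le_slots (hd : 2 ≤ d) (p : unitInterval) (hp : p < criticalProbI d) {m₁ m₂ m₃ M : ℕ}
    (hm : m₂ + m₃ ≤ M) {x : Site d} {X : Set (Site d)} (hx : x ∈ X) {R₁ R₂ R₃ : ℝ}
    (hR₁ : IsRemKernelConst d [M] X R₁) (hR₂ : IsRemKernelConst d [M - m₃, m₃] X R₂)
    (hR₃ : IsRemKernelConst d [M - (m₂ + m₃), m₂, m₃] X R₃) (S₁ S₂ : Finset (Site d)) :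
    ∑ v ∈ S₁, ∑ y ∈ S₂, diagT d p m₁ m₂ m₃ v y x ≤
      (∑ L ∈ Finset.Ico (m₁ + m₂ + m₃) M,
          (((L + 2 - (m₁ + m₂ + m₃)).choose 2 : ℕ) : ℝ) * ((trailWordsTo d L x).card : ℝ) * (p : ℝ) ^ L) +
        (((M + 1 - (m₁ + m₂ + m₃)).choose 2 : ℕ) : ℝ) * ((p : ℝ) ^ M * (nobleSup2 d p * R₁)) +
          ((M - (m₁ + m₂ + m₃) : ℕ) : ℝ) * ((p : ℝ) ^ M * (nobleSup2 d p ^ 2 * R₂)) +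
            (p : ℝ) ^ M * (nobleSup2 d p ^ 3 * R₃) :=
  sum_sum_le_repTriangle_slots (D := fun v y => diagT d p m₁ m₂ m₃ v y x)
    (sum_sum_diagT_le_extraction_choose p m₁ m₂ m₃ M x) hd hp hm hx hR₁ hR₂ hR₃ S₁ S₂

/-! ### F. The repulsive square at abstract slots (hE-form, then discharged) -/

section RepulsiveSquareCell

variable {p : unitInterval} {m₁ m₂ m₃ m₄ M : ℕ} {x : Site d} {D : Site d → Site d → Site d → ℝ} {c₁ : ℝ}
  (hE : ∀ S₁ S₂ S₃ : Finset (Site d), ∑ v ∈ S₁, ∑ y ∈ S₂, ∑ w ∈ S₃, D v y w ≤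
    (∑ L ∈ Finset.Ico (m₁ + m₂ + m₃ + m₄) M,
        (((L + 3 - (m₁ + m₂ + m₃ + m₄)).choose 3 : ℕ) : ℝ) * ((trailWordsTo d L x).card : ℝ) * (p : ℝ) ^ L) +
      c₁ * ((p : ℝ) ^ M * ∑ u ∈ trailWords d M, tau d p 0 (x - wordPos u M)) +
        (((M + 1 - (m₁ + m₂ + m₃ + m₄)).choose 2 : ℕ) : ℝ) * ((p : ℝ) ^ (M - m₄) * (p : ℝ) ^ m₄ *
          ∑ uu ∈ idxTwoTail (d := d) m₄ M,
            ∑ w ∈ S₃, tau d p (wordPos uu.1 (M - m₄)) w * tau d p (w + wordPos uu.2 m₄) x) +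
          ((M - (m₁ + m₂ + m₃ + m₄) : ℕ) : ℝ) *
            ((p : ℝ) ^ (M - (m₃ + m₄)) * (p : ℝ) ^ m₃ * (p : ℝ) ^ m₄ *
              ∑ t ∈ idxThreeTailT (d := d) m₃ m₄ M, ∑ y ∈ S₂, ∑ w ∈ S₃,
                tau d p (wordPos t.1 (M - (m₃ + m₄))) y * tau d p (y + wordPos t.2.1 m₃) w *
                  tau d p (w + wordPos t.2.2 m₄) x) +
            (p : ℝ) ^ (M - (m₂ + m₃ + m₄)) * (p : ℝ) ^ m₂ * (p : ℝ) ^ m₃ * (p : ℝ) ^ m₄ *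
              ∑ t ∈ idxFourTailS (d := d) m₂ m₃ m₄ M, ∑ v ∈ S₁, ∑ y ∈ S₂, ∑ w ∈ S₃,
                tau d p (wordPos t.1 (M - (m₂ + m₃ + m₄))) v * tau d p (v + wordPos t.2.1 m₂) y *
                  tau d p (y + wordPos t.2.2.1 m₃) w * tau d p (w + wordPos t.2.2.2 m₄) x)

include hE

/-- **The repulsive square at abstract remainder-kernel constants, all finite `S₁, S₂, S₃`** (`d ≥ 2`, `p < p_c`,
`m₂ + m₃ + m₄ ≤ M`, `x ∈ X`; `R₁` valid for `[M]`, `R₂` for `[M−m₄, m₄]`, `R₃` for `[M−m₃−m₄, m₃, m₄]`, `R₄` for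
`[M−m₂−m₃−m₄, m₂, m₃, m₄]` on `X`; `hE` = the (5.42)-shaped extraction inequality with a one-tail coefficient
`c₁ ≥ 0` — `C(M+2−m_{1,4},3)` as derived, or the printed over-count `C(M+3−m_{1,4},3)`):
`Σ_{v,y,w} D ≤ Σ_L C(L+3−m,3) a_L(x) p^L + c₁ p^M Γ̄₂ R₁ + C(M+1−m,2) p^M Γ̄₂² R₂ + (M−m) p^M Γ̄₂³ R₃ + p^M Γ̄₂⁴ R₄`.
[cite: FitznerVanDerHofstad2016NoBLE, §5.3.2 (5.42) p. 1098; first display p. 1097]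
[cite: FitznerVanDerHofstad2017, notebook Percolation.nb cells 11, 12 (Bound[OpenSquare,m,s], second Min-argument)] -/
theorem sum3_le_repSquare_slots (hd : 2 ≤ d) (hp : p < criticalProbI d) (hm : m₂ + m₃ + m₄ ≤ M) (hc₁ : 0 ≤ c₁)
    {X : Set (Site d)} (hx : x ∈ X) {R₁ R₂ R₃ R₄ : ℝ} (hR₁ : IsRemKernelConst d [M] X R₁)
    (hR₂ : IsRemKernelConst d [M - m₄, m₄] X R₂) (hR₃ : IsRemKernelConst d [M - (m₃ + m₄), m₃, m₄] X R₃)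
    (hR₄ : IsRemKernelConst d [M - (m₂ + m₃ + m₄), m₂, m₃, m₄] X R₄) (S₁ S₂ S₃ : Finset (Site d)) :
    ∑ v ∈ S₁, ∑ y ∈ S₂, ∑ w ∈ S₃, D v y w ≤
      (∑ L ∈ Finset.Ico (m₁ + m₂ + m₃ + m₄) M,
          (((L + 3 - (m₁ + m₂ + m₃ + m₄)).choose 3 : ℕ) : ℝ) * ((trailWordsTo d L x).card : ℝ) * (p : ℝ) ^ L) +
        c₁ * ((p : ℝ) ^ M * (nobleSup2 d p * R₁)) +
          (((M + 1 - (m₁ + m₂ + m₃ + m₄)).choose 2 : ℕ) : ℝ) * ((p : ℝ) ^ M * (nobleSup2 d p ^ 2 * R₂)) +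
            ((M - (m₁ + m₂ + m₃ + m₄) : ℕ) : ℝ) * ((p : ℝ) ^ M * (nobleSup2 d p ^ 3 * R₃)) +
              (p : ℝ) ^ M * (nobleSup2 d p ^ 4 * R₄) := by
  have hp0 : 0 ≤ (p : ℝ) := p.2.1
  have h4 : m₄ ≤ M := le_trans (Nat.le_add_left m₄ (m₂ + m₃)) hm
  refine (hE S₁ S₂ S₃).trans (add_le_add (add_le_add (add_le_add (add_le_add le_rfl ?_) ?_) ?_) ?_)
  · exact mul_le_mul_of_nonneg_left
      (mul_le_mul_of_nonneg_left (sum_trailWords_tau_le_slot hR₁ p hp hx) (pow_nonneg hp0 M)) hc₁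
  · rw [← pow_add, Nat.sub_add_cancel h4]
    exact mul_le_mul_of_nonneg_left
      (mul_le_mul_of_nonneg_left (sum_prod_trailWords_le_slot hd hR₂ p hp hx S₃) (pow_nonneg hp0 M))
      (Nat.cast_nonneg _)
  · rw [← pow_add, ← pow_add, show M - (m₃ + m₄) + m₃ + m₄ = M by omega]
    exact mul_le_mul_of_nonneg_left
      (mul_le_mul_of_nonneg_left (sum_prod3_trailWords_le_slot hd hR₃ p hp hx S₂ S₃) (pow_nonneg hp0 M))
      (Nat.cast_nonneg _)
  · rw [← pow_add, ← pow_add, ← pow_add, show M - (m₂ + m₃ + m₄) + m₂ + m₃ + m₄ = M by omega]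
    exact mul_le_mul_of_nonneg_left (sum_prod4_trailWords_le_slot hd hR₄ p hp hx S₁ S₂ S₃) (pow_nonneg hp0 M)

end RepulsiveSquareCell

/-- **The open repulsive square `𝓢_{m₁,…,m₄}` at abstract remainder-kernel constants, DISCHARGED** over
`sum3_diagS_le_extraction` ([NoBLE17] (5.42), literature seat gens 11–12) with the closed-form multiplicities of
`RepulsivePolygonMultiplicities` (one-tail `C(M+2−m_{1,4},3)`, two-tail `C(M+1−m_{1,4},2)` — the counts the
derivation yields; HOME D57): `Σ_{v,y,w} 𝓢 ≤ Σ_L C(L+3−m,3) a_L(x) p^L + C(M+2−m,3) p^M Γ̄₂ R₁ + C(M+1−m,2) p^M Γ̄₂² R₂`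
` + (M−m) p^M Γ̄₂³ R₃ + p^M Γ̄₂⁴ R₄`.  Cells 11/12 of `Percolation.nb`, slots `RemRead.cl 3` / `op 3`.
[cite: FitznerVanDerHofstad2016NoBLE, §5.3.2 (5.42) p. 1098; first display p. 1097]
[cite: FitznerVanDerHofstad2017, notebook Percolation.nb cells 11, 12] -/
theorem sum3_diagS_le_slots (hd : 2 ≤ d) (p : unitInterval) (hp : p < criticalProbI d) {m₁ m₂ m₃ m₄ M : ℕ}
    (hm : m₂ + m₃ + m₄ ≤ M) {x : Site d} {X : Set (Site d)} (hx : x ∈ X) {R₁ R₂ R₃ R₄ : ℝ}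
    (hR₁ : IsRemKernelConst d [M] X R₁) (hR₂ : IsRemKernelConst d [M - m₄, m₄] X R₂)
    (hR₃ : IsRemKernelConst d [M - (m₃ + m₄), m₃, m₄] X R₃)
    (hR₄ : IsRemKernelConst d [M - (m₂ + m₃ + m₄), m₂, m₃, m₄] X R₄) (S₁ S₂ S₃ : Finset (Site d)) :
    ∑ v ∈ S₁, ∑ y ∈ S₂, ∑ w ∈ S₃, diagS d p m₁ m₂ m₃ m₄ v y w x ≤
      (∑ L ∈ Finset.Ico (m₁ + m₂ + m₃ + m₄) M,
          (((L + 3 - (m₁ + m₂ + m₃ + m₄)).choose 3 : ℕ) : ℝ) * ((trailWordsTo d L x).card : ℝ) * (p : ℝ) ^ L) +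
        (((M + 2 - (m₁ + m₂ + m₃ + m₄)).choose 3 : ℕ) : ℝ) * ((p : ℝ) ^ M * (nobleSup2 d p * R₁)) +
          (((M + 1 - (m₁ + m₂ + m₃ + m₄)).choose 2 : ℕ) : ℝ) * ((p : ℝ) ^ M * (nobleSup2 d p ^ 2 * R₂)) +
            ((M - (m₁ + m₂ + m₃ + m₄) : ℕ) : ℝ) * ((p : ℝ) ^ M * (nobleSup2 d p ^ 3 * R₃)) +
              (p : ℝ) ^ M * (nobleSup2 d p ^ 4 * R₄) :=
  sum3_le_repSquare_slots (D := fun v y w => diagS d p m₁ m₂ m₃ m₄ v y w x)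
    (sum3_diagS_le_extraction_choose p m₁ m₂ m₃ m₄ M x) hd hp hm (Nat.cast_nonneg _) hx hR₁ hR₂ hR₃ hR₄ S₁ S₂ S₃

/-- **The repulsive square at abstract slots with the PRINTED one-tail coefficient** `(1/6)∏_{s=1}^{3}(M−m_{1,4}+s)
= C(M+3−m_{1,4},3)` of (5.42) (a valid over-count of the derived `C(M+2−m_{1,4},3)`), the other multiplicities as the
derivation yields them (`sum3_diagS_le_extraction_printedShape`).
[cite: FitznerVanDerHofstad2016NoBLE, §5.3.2 (5.42) p. 1098; first display p. 1097] -/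
theorem sum3_diagS_le_slots_printedOneTail (hd : 2 ≤ d) (p : unitInterval) (hp : p < criticalProbI d)
    {m₁ m₂ m₃ m₄ M : ℕ} (hm : m₂ + m₃ + m₄ ≤ M) {x : Site d} {X : Set (Site d)} (hx : x ∈ X)
    {R₁ R₂ R₃ R₄ : ℝ} (hR₁ : IsRemKernelConst d [M] X R₁) (hR₂ : IsRemKernelConst d [M - m₄, m₄] X R₂)
    (hR₃ : IsRemKernelConst d [M - (m₃ + m₄), m₃, m₄] X R₃)
    (hR₄ : IsRemKernelConst d [M - (m₂ + m₃ + m₄), m₂, m₃, m₄] X R₄) (S₁ S₂ S₃ : Finset (Site d)) :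
    ∑ v ∈ S₁, ∑ y ∈ S₂, ∑ w ∈ S₃, diagS d p m₁ m₂ m₃ m₄ v y w x ≤
      (∑ L ∈ Finset.Ico (m₁ + m₂ + m₃ + m₄) M,
          (((L + 3 - (m₁ + m₂ + m₃ + m₄)).choose 3 : ℕ) : ℝ) * ((trailWordsTo d L x).card : ℝ) * (p : ℝ) ^ L) +
        (((M + 3 - (m₁ + m₂ + m₃ + m₄)).choose 3 : ℕ) : ℝ) * ((p : ℝ) ^ M * (nobleSup2 d p * R₁)) +
          (((M + 1 - (m₁ + m₂ + m₃ + m₄)).choose 2 : ℕ) : ℝ) * ((p : ℝ) ^ M * (nobleSup2 d p ^ 2 * R₂)) +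
            ((M - (m₁ + m₂ + m₃ + m₄) : ℕ) : ℝ) * ((p : ℝ) ^ M * (nobleSup2 d p ^ 3 * R₃)) +
              (p : ℝ) ^ M * (nobleSup2 d p ^ 4 * R₄) :=
  sum3_le_repSquare_slots (D := fun v y w => diagS d p m₁ m₂ m₃ m₄ v y w x)
    (sum3_diagS_le_extraction_printedShape p m₁ m₂ m₃ m₄ M x) hd hp hm (Nat.cast_nonneg _) hx hR₁ hR₂ hR₃ hR₄
    S₁ S₂ S₃

end Literature.Probability.FitznerVanDerHofstad2017

end
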